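import Mathlib
import HarnessLib
import Summits.HodgeConjecture.HodgeConjecture.Theses.LinearSystemTorelli
import Literature.AlgebraicGeometry.HodgeTheory.FermatDiagonalAction
import Literature.AlgebraicGeometry.HodgeTheory.FermatHypersurfaceReduction

/-!
# Sketch — crux-ideate stmt-HodgeConjecture-2409 (`MiddleDivisorSupportFourfold`), ideator 2, round 1

First lemmas for the crux idea card `griffiths-incidence-divisor-support`
(Griffiths' Chapter XVII infinitesimal-invariant programme aimed at DIVISOR support on fourfolds).

Step 0 of the line (typed here): the Green–Griffiths normal function `ν_c` exists for classes that
vanish on the smooth hyperplane sections (`L`-primitive classes); every rational `(2,2)` class is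
such a class plus `h ∪ (rational (1,1) class) + a·h²`, which is algebraic by Lefschetz `(1,1)`, hence
supported on a divisor. So the crux reduces to `L`-primitive classes (`PrimitiveReduction`).
The later stubs of the line (log-Dolbeault support criterion, Griffiths' incidence variety
`I(c,ℓ) ⊂ |K_X(ℓ+1)|`, the generation statement) need `Ω²(log D)` / IVHS objects the tree lacks and
stay informal on the card.
-/

namespace Summit.HodgeConjecture.HodgeConjecture.Cruxes.MiddleDivisorSupportFourfold.GriffithsIncidence

open CategoryTheory AlgebraicGeometry
open Literature.AlgebraicGeometry.Motives Literature.AlgebraicGeometry.HodgeTheory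

/-- The point set of the hyperplane section `X ∩ {F = 0}` cut by a linear form `F` in the chosen
projective embedding `e : X ↪ ℙⁿ` (as a subset of the underlying space of the scheme `X`). -/
def hyperplaneSectionSet {X : SchemeOver ℂ} (e : ProjectiveEmbedding X)
    (F : MvPolynomial (Fin (e.n + 1)) ℂ) : Set X.left :=
  e.ι.left.base ⁻¹'
    (letI := MvPolynomial.gradedAlgebra (σ := Fin (e.n + 1)) (R := ℂ)
     (ProjectiveSpectrum.zeroLocus (MvPolynomial.homogeneousSubmodule (Fin (e.n + 1)) ℂ)
        ({F} : Set (MvPolynomial (Fin (e.n + 1)) ℂ)) : Set _))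

/-- `c ∈ H⁴(X(ℂ);ℂ)` is `L`-PRIMITIVE for the embedding `e` (in the weak, support-theoretic sense
the line needs): it pulls back to zero along every closed immersion `ι : Y ↪ X` of a SMOOTH
projective threefold whose image is a hyperplane section `X ∩ {F = 0}`, `F` a non-zero linear
form. For a rational `(2,2)` class this is `c ∪ h = 0` (hard Lefschetz: `ι_* : H⁴(Y) → H⁶(X)` is an
isomorphism for smooth ample threefold sections), i.e. membership in `P⁴(X) = ker(H⁴(X) → H⁴(Y))`,
the domain of the Green–Griffiths normal function `ν_c` (Griffiths, AM-106 Ch. XIV/XVII). Singular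
sections are deliberately excluded (a primitive class may restrict non-trivially to a singular
section — that is Kerr–Pearlstein Conj. 41). -/
def IsLPrimitive {X : SchemeOver ℂ} (e : ProjectiveEmbedding X) (c : complexBetti X 4) : Prop :=
  ∀ (Y : SchemeOver ℂ) (ι : Y ⟶ X) (F : MvPolynomial (Fin (e.n + 1)) ℂ),
    IsSmoothProjective 3 Y → IsClosedImmersion ι.left → F.IsHomogeneous 1 → F ≠ 0 →
    Set.range ι.left.base = hyperplaneSectionSet e F →
    complexBetti.map ι 4 c = 0

/-- The `L`-primitive case of the crux: every rational `(2,2)` class on a smooth projective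
fourfold which dies on all smooth hyperplane sections of some projective embedding is supported
on a divisor. This is the statement Griffiths' Chapter XVII programme attacks (normal function
`ν_c` over `|𝒪_X(ℓ)|`, infinitesimal invariant `δν_c`, incidence variety `I(c,ℓ) ⊂ |K_X(ℓ+1)|`). -/
def PrimitiveCaseFourfold : Prop :=
  ∀ ⦃X : SchemeOver ℂ⦄, IsSmoothProjective 4 X → ∀ (e : ProjectiveEmbedding X)
    (c : complexBetti X 4), IsRationalClass c → IsOfHodgeType 4 X 4 2 2 c → IsLPrimitive e c →
    c ∈ supportedClasses X 4 1

/-- FIRST LEMMA of the line (step 0, "it suffices to treat primitive classes"): the `L`-primitive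
case implies the crux `MiddleDivisorSupportFourfold` BY NAME. Proof route (not done here):
rational Lefschetz decomposition `c = c₀ + h ∪ c₂ + a·h²` with `c₀` primitive and `c₂` a rational
`(1,1)` class (VoisinHodgeI2002 Thm 6.25 + compatibility with the Hodge decomposition),
`lefschetzOneOne_rational` for `c₂`, cup product with the hyperplane class preserves
`algebraicClasses` (`AlgebraicClassesCup`), `algebraicClasses X 2 ≤ supportedClasses X 4 1`
(`supportedClasses_mono`), and `c₀ ∈ supportedClasses` by hypothesis. -/
def PrimitiveReduction : Prop :=
  PrimitiveCaseFourfold →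
    Summit.HodgeConjecture.HodgeConjecture.Theses.LinearSystemTorelli.MiddleDivisorSupportFourfold

/-- Sanity (trivial direction, provable now): the crux implies its primitive case. -/
theorem primitiveCase_of_crux
    (h : Summit.HodgeConjecture.HodgeConjecture.Theses.LinearSystemTorelli.MiddleDivisorSupportFourfold) :
    PrimitiveCaseFourfold :=
  fun _X hX _e c hc hh _ => h hX c hc hh

end Summit.HodgeConjecture.HodgeConjecture.Cruxes.MiddleDivisorSupportFourfold.GriffithsIncidence

/-!
## Card `isotypic-pencil-support` — equivariant Leray vanishing over invariant pencils

Schema (informal; families + group actions are too heavy to type here): `H ⊂ Aut(X,L)` finite,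
`Λ ⊂ |L^N|` a pencil of `H`-semi-invariant sections of one character, `U ⊂ Λ` the locus of smooth
(or equisingular, resolved) members, `K` = characters of `H` occurring in NO `Hⁱ(X_s(ℂ);ℂ)`,
`s ∈ U`. Then the `K`-isotypic part of `H⁴(X(ℂ);ℂ)` restricts to zero on the total space of the
family over `U` (Leray degenerates, Deligne; isotypic parts are exact), hence is supported on the
finitely many singular members: it lies in `supportedClasses X 4 1`.

CALIBRATION typed below: the Fermat fourfold `X⁴ₘ` and the hyperplane pencil `{x₅ = λ x₄}`, stable
under `H = {ζ₄ = ζ₅} ⊂ μₘ⁶`; its smooth members are Fermat threefolds whose cohomology characters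
have all five entries non-zero, so `χ_α|_H = (α₀,…,α₃, α₄+α₅)` is absent iff `α₄ + α₅ = 0`; the
singular members are the `m` cones `λᵐ = −1` over the Fermat surface. Output = Shioda's inductive
structure of type P1(1,3) (cones over curves on the Fermat surface), obtained WITHOUT cycles.
-/

namespace Summit.HodgeConjecture.HodgeConjecture.Cruxes.MiddleDivisorSupportFourfold.IsotypicPencil

open CategoryTheory AlgebraicGeometry
open Literature.AlgebraicGeometry.Motives Literature.AlgebraicGeometry.HodgeTheory

/-- FIRST LEMMA (calibration, a theorem in print in cycle form = Shioda 1979 type I): on the Fermat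
fourfold `X⁴ₘ = V₊(Σ xᵢᵐ) ⊂ ℙ⁵`, every eigenspace `V(α) ⊆ H⁴(X⁴ₘ(ℂ);ℂ)` of the diagonal group
`μₘ⁶` whose character has a PAIRED TAIL `α₄ + α₅ = 0` is supported on a divisor — by the pencil
argument, on the union of the `m` cone sections `X⁴ₘ ∩ {x₅ = λx₄}`, `λᵐ = -1`. (For `α` with some
other `αᵢ = 0` or `Σ αᵢ ≠ 0` the eigenspace is `⊥` or `ℂ·h²`, so the statement is true for every
`α`; the content is `α ∈ 𝔄⁴ₘ`.) [cite: Shioda1979HodgeFermat, Thm. I / da Silva arXiv:2101.04739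
Thm 2.2, Cor 2.3 (P1)] -/
def PairedTailSupported (m : ℕ) [NeZero m] : Prop :=
  ∀ α : Fin (4 + 2) → ZMod m, α 4 + α 5 = 0 →
    fermatEigenspace m α 4 ≤ supportedClasses (fermatHypersurface 4 m) 4 1

/-- The Fermat-sector form of the crux in isotypic clothing: every eigenspace of a HODGE character
(all `V(tα)`, `t ∈ (ℤ/m)ˣ`, of type `(2,2)` — Shioda's `𝔅⁴ₘ`; stated here simply for every `α`
whose eigenspace consists of classes of Hodge type `(2,2)`) is divisor-supported. With
`DivisorInduction (3,2)` + Lefschetz `(1,1)` this is HC for `X⁴ₘ` (open for `m = 33`, da Silva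
arXiv:2101.04739 Prop. 3.6). The card's engine attacks it pencil by pencil: `V(α) ≤ N¹` whenever
`χ_α|_H` is absent from the cohomology of the smooth members of some `H`-invariant pencil. -/
def FermatFourfoldEigenSupport (m : ℕ) [NeZero m] : Prop :=
  ∀ α : Fin (4 + 2) → ZMod m,
    (∀ c ∈ fermatEigenspace m α 4, IsOfHodgeType 4 (fermatHypersurface 4 m) 4 2 2 c) →
    fermatEigenspace m α 4 ≤ supportedClasses (fermatHypersurface 4 m) 4 1

/-- Sanity glue (provable now): the crux implies the Fermat-sector statement for eigenspaces all of
whose classes are RATIONAL-spanned Hodge classes — recorded only as the direction crux ⇒ sector for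
rational classes: a rational `(2,2)` class on `X⁴ₘ` is divisor-supported. -/
theorem fermat_rational_of_crux {m : ℕ} (hm : 1 ≤ m)
    (h : Summit.HodgeConjecture.HodgeConjecture.Theses.LinearSystemTorelli.MiddleDivisorSupportFourfold)
    (c : complexBetti (fermatHypersurface 4 m) 4) (hc : IsRationalClass c)
    (hh : IsOfHodgeType 4 (fermatHypersurface 4 m) 4 2 2 c) :
    c ∈ supportedClasses (fermatHypersurface 4 m) 4 1 :=
  h (isSmoothHypersurface_fermatHypersurface (by norm_num) hm).1 c hc hh

end Summit.HodgeConjecture.HodgeConjecture.Cruxes.MiddleDivisorSupportFourfold.IsotypicPencil
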